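import Summits.CriticalPhenomena.PercolationContinuityZ3.Theorems.SahiAEFourFunctions

/-!
# Marginals of densities that are MTP₂ on almost every pair (Karlin–Rinott Prop. 3.2, a.e. form)

Support file of the Sahi cell (`prim-sahi`, typer seat, generation 19; `--supports stmt-CriticalPhenomena-4575`).
Theorems only (no definitions, no named facts, no sorries).

* `ae_ae_insertNth_of_ae_pair` — transport of an almost-everywhere statement about PAIRS of points of `ℝ^{n+1}`
  (product reference measure `∏μⱼ`, squared) to "for a.e. pair of base points of `ℝⁿ` (coordinate `i` deleted),
  for a.e. pair of heights": `ℝ^{n+1} ≃ ℝ × ℝⁿ` squared (`measurePreserving_piFinSuccAbove`), re-association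
  (`measurePreserving_shuffle`) and Fubini (`Measure.ae_ae_of_ae_prod`).  Any predicate, no measurability.
* `fourFunctions_marginal_ae_pair` — [KarlinRinott1980] §2, "the marginals continue to satisfy (2.1)", a.e. form: if
  `f₁(x) f₂(y) ≤ f₃(x ∨ y) f₄(x ∧ y)` for a.e. pair on `ℝ^{n+1}`, the Lebesgue marginals over coordinate `i` satisfy
  it for a.e. pair on `ℝⁿ`.
* `lmarginal_ae_mtp2` — [KarlinRinott1980] (1.15)–(1.16) / Prop. 3.2 in the a.e. form: the one-coordinate Lebesgue
  marginal of a measurable kernel `g : ℝ^{n+1} → [0,∞]` that is MTP₂ on ALMOST EVERY PAIR is MTP₂ on almost every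
  pair of `ℝⁿ` (so, inductively, all marginal densities of an a.e.-pair MTP₂ density are a.e.-pair MTP₂).
* `tp2Density_marginal_ae` — the two-density cross condition (2.8) is likewise inherited by marginals, a.e. form.

ATTRIBUTION (doc-only v2, cell finding A33-1).  "Marginals of `μ`-compatible quadruples are `μ`-compatible" on
finite products of totally ordered σ-finite measure spaces is [BattyBollmann1980] Lemma 3.6 (the `μ`-compatible
case); the three marginal theorems below are that lemma on `ℝ^{n+1}` for the quadruples `(f₁,f₂,f₃,f₄)`, `(g,g,g,g)`
and `(f,g,g,f)` and are now tagged accordingly.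

No sorries, no new axioms.
-/

noncomputable section

namespace Summit.CriticalPhenomena.PercolationContinuityZ3.Theorems.SahiAEFourFunctions

open MeasureTheory Set Filter
open scoped ENNReal

variable {n : ℕ}

/-- **Transport of an a.e.-pair statement through `ℝ^{n+1} ≃ ℝ × ℝⁿ`**: if `P` holds for `(∏μⱼ) ⊗ (∏μⱼ)`-almost
every pair of points of `ℝ^{n+1}`, then for almost every pair `(y, z)` of base points (coordinate `i` deleted) and,
given those, almost every pair of heights `(t, s)`, `P (y with xᵢ := t, z with xᵢ := s)`. [this work] -/
theorem ae_ae_insertNth_of_ae_pair (μ : Fin (n + 1) → Measure ℝ) [∀ j, SigmaFinite (μ j)] (i : Fin (n + 1))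
    {P : (Fin (n + 1) → ℝ) × (Fin (n + 1) → ℝ) → Prop}
    (h : ∀ᵐ p ∂(Measure.pi μ).prod (Measure.pi μ), P p) :
    ∀ᵐ q ∂(Measure.pi fun j => μ (i.succAbove j)).prod (Measure.pi fun j => μ (i.succAbove j)),
      ∀ᵐ r ∂(μ i).prod (μ i), P (Fin.insertNth i r.1 q.1, Fin.insertNth i r.2 q.2) := by
  set ν := μ i with hν
  set μ' : Fin n → Measure ℝ := fun j => μ (i.succAbove j) with hμ'
  have hmp := measurePreserving_piFinSuccAbove μ i
  set e := MeasurableEquiv.piFinSuccAbove (fun _ : Fin (n + 1) => ℝ) i with he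
  have hsymm : MeasurePreserving e.symm (ν.prod (Measure.pi μ')) (Measure.pi μ) := hmp.symm _
  have h3 := (hsymm.prod hsymm).quasiMeasurePreserving.ae h
  have h4 := (measurePreserving_shuffle (Measure.pi μ') (Measure.pi μ') ν ν).quasiMeasurePreserving.ae h3
  have h5 := Measure.ae_ae_of_ae_prod h4
  filter_upwards [h5] with q hq
  filter_upwards [hq] with r hr
  simpa [he, MeasurableEquiv.piFinSuccAbove_symm_apply, Fin.insertNthEquiv, Prod.map] using hr

variable {f₁ f₂ f₃ f₄ : (Fin (n + 1) → ℝ) → ℝ≥0∞}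

/-- **"The marginals continue to satisfy (2.1)", a.e. form**: if `f₁(x) f₂(y) ≤ f₃(x ∨ y) f₄(x ∧ y)` for
`(∏μⱼ) ⊗ (∏μⱼ)`-a.e. `(x,y)` in `ℝ^{n+1}` (measurable `fⱼ : ℝ^{n+1} → [0,∞]`), then the Lebesgue marginals over
coordinate `i`, `Φⱼ(y) = ∫⁻ fⱼ(xᵢ := t, y) dμᵢ(t)`, satisfy `Φ₁(y) Φ₂(z) ≤ Φ₃(y ∨ z) Φ₄(y ∧ z)` for a.e. pair
`(y,z)` in `ℝⁿ`. [cite: BattyBollmann1980, Lemma 3.6] -/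
theorem fourFunctions_marginal_ae_pair (μ : Fin (n + 1) → Measure ℝ) [∀ j, SigmaFinite (μ j)]
    (hm₁ : Measurable f₁) (hm₂ : Measurable f₂) (hm₃ : Measurable f₃) (hm₄ : Measurable f₄)
    (h : ∀ᵐ p ∂(Measure.pi μ).prod (Measure.pi μ), f₁ p.1 * f₂ p.2 ≤ f₃ (p.1 ⊔ p.2) * f₄ (p.1 ⊓ p.2))
    (i : Fin (n + 1)) :
    ∀ᵐ q ∂(Measure.pi fun j => μ (i.succAbove j)).prod (Measure.pi fun j => μ (i.succAbove j)),
      (∫⁻ t, f₁ (Fin.insertNth i t q.1) ∂μ i) * (∫⁻ t, f₂ (Fin.insertNth i t q.2) ∂μ i) ≤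
        (∫⁻ t, f₃ (Fin.insertNth i t (q.1 ⊔ q.2)) ∂μ i) * (∫⁻ t, f₄ (Fin.insertNth i t (q.1 ⊓ q.2)) ∂μ i) := by
  filter_upwards [ae_ae_insertNth_of_ae_pair μ i h] with q hq
  exact fourFunctions_marginal_ae (μ i) hm₁ hm₂ hm₃ hm₄ i q.1 q.2 hq

/-- **Karlin–Rinott (1.15)–(1.16) / Prop. 3.2, almost-everywhere form**: for a measurable kernel
`g : ℝ^{n+1} → [0,∞]` with `g(x) g(y) ≤ g(x ∨ y) g(x ∧ y)` for `(∏μⱼ) ⊗ (∏μⱼ)`-ALMOST EVERY `(x, y)`, the Lebesgue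
marginal `Φ(y) = ∫⁻ g(xᵢ := t, y) dμᵢ(t)` satisfies `Φ(y) Φ(z) ≤ Φ(y ∨ z) Φ(y ∧ z)` for almost every pair `(y, z)`
of `ℝⁿ` — a.e.-pair MTP₂ is inherited by marginal densities. [cite: BattyBollmann1980, Lemma 3.6 (quadruple (g,g,g,g))]
[cite: KarlinRinott1980, Prop. 3.2] -/
theorem lmarginal_ae_mtp2 (μ : Fin (n + 1) → Measure ℝ) [∀ j, SigmaFinite (μ j)]
    {g : (Fin (n + 1) → ℝ) → ℝ≥0∞} (hgm : Measurable g)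
    (hg : ∀ᵐ p ∂(Measure.pi μ).prod (Measure.pi μ), g p.1 * g p.2 ≤ g (p.1 ⊔ p.2) * g (p.1 ⊓ p.2))
    (i : Fin (n + 1)) :
    ∀ᵐ q ∂(Measure.pi fun j => μ (i.succAbove j)).prod (Measure.pi fun j => μ (i.succAbove j)),
      (∫⁻ t, g (Fin.insertNth i t q.1) ∂μ i) * (∫⁻ t, g (Fin.insertNth i t q.2) ∂μ i) ≤
        (∫⁻ t, g (Fin.insertNth i t (q.1 ⊔ q.2)) ∂μ i) * (∫⁻ t, g (Fin.insertNth i t (q.1 ⊓ q.2)) ∂μ i) :=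
  fourFunctions_marginal_ae_pair μ hgm hgm hgm hgm hg i

/-- **The two-density cross condition (2.8) is inherited by marginals, a.e. form**: if
`f(x) g(y) ≤ f(x ∧ y) g(x ∨ y)` for a.e. pair in `ℝ^{n+1}` then the one-coordinate Lebesgue marginals `F, G` satisfy
`F(y) G(z) ≤ F(y ∧ z) G(y ∨ z)` for a.e. pair in `ℝⁿ` (the four functions `f, g, g, f`).
[cite: BattyBollmann1980, Lemma 3.6 (quadruple (f,g,g,f))] -/
theorem tp2Density_marginal_ae (μ : Fin (n + 1) → Measure ℝ) [∀ j, SigmaFinite (μ j)]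
    {f g : (Fin (n + 1) → ℝ) → ℝ≥0∞} (hf : Measurable f) (hg : Measurable g)
    (hfg : ∀ᵐ p ∂(Measure.pi μ).prod (Measure.pi μ), f p.1 * g p.2 ≤ f (p.1 ⊓ p.2) * g (p.1 ⊔ p.2))
    (i : Fin (n + 1)) :
    ∀ᵐ q ∂(Measure.pi fun j => μ (i.succAbove j)).prod (Measure.pi fun j => μ (i.succAbove j)),
      (∫⁻ t, f (Fin.insertNth i t q.1) ∂μ i) * (∫⁻ t, g (Fin.insertNth i t q.2) ∂μ i) ≤
        (∫⁻ t, f (Fin.insertNth i t (q.1 ⊓ q.2)) ∂μ i) * (∫⁻ t, g (Fin.insertNth i t (q.1 ⊔ q.2)) ∂μ i) := by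
  have h' : ∀ᵐ p ∂(Measure.pi μ).prod (Measure.pi μ), f p.1 * g p.2 ≤ g (p.1 ⊔ p.2) * f (p.1 ⊓ p.2) := by
    filter_upwards [hfg] with p hp
    rwa [mul_comm (g _)]
  filter_upwards [fourFunctions_marginal_ae_pair μ hf hg hg hf h' i] with q hq
  rwa [mul_comm (∫⁻ t, g _ ∂μ i)] at hq

end Summit.CriticalPhenomena.PercolationContinuityZ3.Theorems.SahiAEFourFunctions
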